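import Summits.Ventures.AbcSig.Recipes.BS04Normal

/-!
# Venture AbcSig — ROW TEMPLATE for `xⁿ + yⁿ = C z²` (`C ≥ 3` odd squarefree): levels `2C²` and `32C²`

HONEST FRAMING. Fully PROVED template theorems of a COMPUTATION cell (`pub-abcsig`); CONDITIONAL on named hypotheses,
no claim on ABC or any summit. They package, once and for all `C`, the elementary part of a census row of the cell's
line C1 ([BS04, Thm. 1.1]-type statements `xⁿ + yⁿ = C z²`): by [BS04, Lemma 2.1/3.2] a primitive solution with
`xy` even falls in case (v) (`ord₂(yⁿ) ≥ 7` after swapping, `z ≡ C (mod 4)` after a sign change) at level `2·C²`, and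
one with `xy` odd in case (i) (`y ≡ −C (mod 4)` after swapping, `case_i_or_swap`) at level `32·C²`; the trivial
`|xy| = 1` candidates are not solutions for `C ≥ 3`. GIVEN, for the exponent `n` (prime, `≥ 7`, `n ∤ C`):
`BS04Package M` (cited), `DataComplete M N orbits_N` (computed) and, for every orbit of the level, either a kernel
sieve certificate (`OrbitData.Eliminated`) or a cited exclusion (`Excludes`) — exactly the output of a generated
`Levels/N….lean` file's `levelN_sieve` — the conclusion is `¬ IsPrimitiveSolution 1 1 C n a b c` (with the parity
restriction of the half used). A concrete row is then ~15 lines: see `Rows/XnYn5Z2.lean`, `Rows/XnYn17Z2Even.lean`.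

* `bs04OddLevel_one_one` — `∏_{p | C, p odd, p ≠ n} p² = C²` for odd squarefree `C`, `n ∤ C`;
* `no_trivial_solution` — `|ab| = 1` is impossible for `C ≥ 3`;
* `row_template_even` / `row_template_odd` / `row_template` — the three row shapes.

Reference: [BS04] M. A. Bennett, C. M. Skinner, Canad. J. Math. 56 (2004) 23–54, §§2–5.
-/

namespace Summit.Ventures.AbcSig

/-- For odd squarefree `C` and `n ∤ C`: the odd part of the Serre level for `(A, B, C) = (1, 1, C)` is `C²`. -/
theorem bs04OddLevel_one_one (C n : ℕ) (hsq : Squarefree C) (hodd : Odd C) (hnC : ¬ n ∣ C) :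
    bs04OddLevel 1 1 C n = C ^ 2 := by
  have hfilt : C.primeFactors.filter (fun p => p ≠ 2 ∧ p ≠ n) = C.primeFactors := by
    apply Finset.filter_true_of_mem
    intro p hp
    have hpd : p ∣ C := Nat.dvd_of_mem_primeFactors hp
    refine ⟨?_, ?_⟩
    · rintro rfl
      exact (Nat.not_even_iff_odd.mpr hodd) (even_iff_two_dvd.mpr hpd)
    · rintro rfl
      exact hnC hpd
  simp only [bs04OddLevel, hfilt, mul_one, Nat.primeFactors_one, Finset.filter_empty, Finset.prod_empty]
  rw [Finset.prod_pow, Nat.prod_primeFactors_of_squarefree hsq]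

/-- Levels for `(1, 1, C)`, `C` odd squarefree, `n ∤ C`: case (v₇) gives `2·C²`, case (i) gives `32·C²`. -/
theorem bs04Level_one_one (C n : ℕ) (hsq : Squarefree C) (hodd : Odd C) (hnC : ¬ n ∣ C) :
    bs04Level .v₇ 1 1 C n = 2 * C ^ 2 ∧ bs04Level .i 1 1 C n = 32 * C ^ 2 := by
  simp only [bs04Level, FreyCase.twoExp, bs04OddLevel_one_one C n hsq hodd hnC]
  norm_num

/-- The candidates with `|ab| = 1` are not solutions of `aⁿ + bⁿ = C c²`, `c ≠ 0`, when `C ≥ 3` and `n` is odd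
(`aⁿ + bⁿ ∈ {0, ±2}`). -/
theorem no_trivial_solution (C : ℕ) (hC3 : 3 ≤ C) (n : ℕ) (hn : Odd n) (a b c : ℤ)
    (hab : a * b = 1 ∨ a * b = -1) (hCc : (C : ℤ) * c ≠ 0) (heq : a ^ n + b ^ n = C * c ^ 2) : False := by
  have key : a ^ n + b ^ n = 2 ∨ a ^ n + b ^ n = 0 ∨ a ^ n + b ^ n = -2 := by
    rcases hab with h | h
    · rcases Int.eq_one_or_neg_one_of_mul_eq_one' h with ⟨rfl, rfl⟩ | ⟨rfl, rfl⟩ <;> simp [hn.neg_one_pow]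
    · rcases Int.eq_one_or_neg_one_of_mul_eq_neg_one' h with ⟨rfl, rfl⟩ | ⟨rfl, rfl⟩ <;> simp [hn.neg_one_pow]
  have hc : c ≠ 0 := by
    rintro rfl
    simp at hCc
  have hc2 : 1 ≤ c ^ 2 := by
    have h1 : c ^ 2 ≠ 0 := pow_ne_zero 2 hc
    have h2 : 0 ≤ c ^ 2 := sq_nonneg c
    omega
  have hC3' : (3 : ℤ) ≤ C := by exact_mod_cast hC3
  have h3 : (3 : ℤ) ≤ (C : ℤ) * c ^ 2 := by nlinarith
  rcases key with h | h | h <;> linarith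

/-- **Row template, `xy` even.** For odd squarefree `C ≥ 3`, a prime `n ≥ 7` with `n ∤ C`, and the cell's
hypotheses at level `2C²` for this `n` (package; data; per orbit a kernel certificate or a cited exclusion for the
family "`(1, 1, C)`, exponent `n`, `xy` even"), there is no primitive solution with `xy` even. -/
theorem row_template_even (C : ℕ) (hsq : Squarefree C) (hCodd : Odd C) (M : NewformModel)
    (hP : M.BS04Package) {orbsE : List OrbitData} (hDE : M.DataComplete (2 * C ^ 2) orbsE)
    (n : ℕ) (hn : n.Prime) (h7 : 7 ≤ n) (hnC : ¬ n ∣ C)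
    (hE : ∀ o ∈ orbsE, (∀ e ∈ o.coeffs, e.ell.Prime ∧ e.ell ≠ 2 ∧ ¬ e.ell ∣ 2 * C ^ 2) ∧
      (o.Eliminated bs04Allowed n ∨ M.Excludes (2 * C ^ 2) o
        (fun S => S.A = 1 ∧ S.B = 1 ∧ S.C = C ∧ S.n = n ∧ 2 ∣ S.a * S.b)))
    (a b c : ℤ) (heven : 2 ∣ a * b) : ¬ IsPrimitiveSolution 1 1 C n a b c := by
  intro hsol
  have hCpos : 0 < C := hCodd.pos
  have hCoddZ : ¬ 2 ∣ (C : ℤ) := by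
    intro h
    have h' : (2 : ℕ) ∣ C := by exact_mod_cast h
    exact (Nat.not_even_iff_odd.mpr hCodd) (even_iff_two_dvd.mpr h')
  -- WLOG `b` even
  obtain ⟨a', b', hsol', hb', hab'⟩ :
      ∃ a' b' : ℤ, IsPrimitiveSolution 1 1 C n a' b' c ∧ 2 ∣ b' ∧ a' * b' = a * b := by
    rcases Int.prime_two.dvd_mul.mp heven with h2 | h2
    · exact ⟨b, a, hsol.swap, h2, mul_comm _ _⟩
    · exact ⟨a, b, hsol, h2, rfl⟩
  -- `c` odd, sign of `c`
  have hc2 : ¬ 2 ∣ c := by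
    intro h2c
    obtain ⟨-, -, -, -, -, -, hbc⟩ := hsol'
    have hu := hbc.isUnit_of_dvd' (by simpa using hb') (Dvd.dvd.mul_left h2c _)
    rcases Int.isUnit_iff.mp hu with h | h <;> omega
  obtain ⟨c', hc'sgn, hc'⟩ := exists_sign_sub_four_dvd c C hc2 hCoddZ
  have hsol'' : IsPrimitiveSolution 1 1 C n a' b' c' := hsol'.of_sign hc'sgn
  have hcase : FreyCase.Holds .v₇ 1 1 C n a' b' c' := by
    refine ⟨?_, hc'⟩
    have h2n : (2 : ℤ) ^ 7 ∣ b' ^ n := (pow_dvd_pow 2 h7).trans (pow_dvd_pow_of_dvd hb' n)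
    simpa using h2n
  have hndvd : ¬ n ∣ 1 * 1 * C := by simpa using hnC
  have hfree : ∀ q : ℕ, q.Prime → ¬ q ^ n ∣ 1 ∧ ¬ q ^ n ∣ 1 := by
    intro q hq
    have : ¬ q ^ n ∣ 1 := by
      intro h
      have h1 := Nat.dvd_one.mp h
      rw [Nat.pow_eq_one] at h1
      rcases h1 with h1 | h1
      · exact hq.one_lt.ne' h1
      · omega
    exact ⟨this, this⟩
  have hab1 : a' * b' ≠ 1 := by
    intro h; rw [h] at hab'; omega
  have hab2 : a' * b' ≠ -1 := by
    intro h; rw [h] at hab'; omega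
  obtain ⟨hlev, hmod⟩ := hP ⟨1, 1, C, n, a', b', c'⟩ .v₇ one_pos one_pos hCpos hsq hn h7 hndvd hfree
    hsol'' hab1 hab2 hcase
  obtain ⟨f, hf⟩ := hlev (2 * C ^ 2) (bs04Level_one_one C n hsq hCodd hnC).1
  have heven' : 2 ∣ a' * b' := by rw [hab']; exact heven
  exact M.no_newform_arises orbsE hDE (fun S => S.A = 1 ∧ S.B = 1 ∧ S.C = C ∧ S.n = n ∧ 2 ∣ S.a * S.b)
    ⟨1, 1, C, n, a', b', c'⟩ ⟨rfl, rfl, rfl, rfl, heven'⟩ bs04Allowed hE f hf (hmod _ f hf)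

/-- **Row template, `xy` odd.** For odd squarefree `C ≥ 3`, a prime `n ≥ 7` with `n ∤ C`, and the cell's
hypotheses at level `32C²` for this `n` (family "`(1, 1, C)`, exponent `n`, `xy` odd"), there is no primitive
solution with `xy` odd. -/
theorem row_template_odd (C : ℕ) (hC3 : 3 ≤ C) (hsq : Squarefree C) (hCodd : Odd C) (M : NewformModel)
    (hP : M.BS04Package) {orbsO : List OrbitData} (hDO : M.DataComplete (32 * C ^ 2) orbsO)
    (n : ℕ) (hn : n.Prime) (h7 : 7 ≤ n) (hnC : ¬ n ∣ C)
    (hO : ∀ o ∈ orbsO, (∀ e ∈ o.coeffs, e.ell.Prime ∧ e.ell ≠ 2 ∧ ¬ e.ell ∣ 32 * C ^ 2) ∧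
      (o.Eliminated bs04Allowed n ∨ M.Excludes (32 * C ^ 2) o
        (fun S => S.A = 1 ∧ S.B = 1 ∧ S.C = C ∧ S.n = n ∧ ¬ 2 ∣ S.a * S.b)))
    (a b c : ℤ) (hodd : ¬ 2 ∣ a * b) : ¬ IsPrimitiveSolution 1 1 C n a b c := by
  intro hsol
  have hCpos : 0 < C := hCodd.pos
  have hnodd : Odd n := hn.odd_of_ne_two (by omega)
  have hCoddZ : ¬ 2 ∣ (C : ℤ) := by
    intro h
    have h' : (2 : ℕ) ∣ C := by exact_mod_cast h
    exact (Nat.not_even_iff_odd.mpr hCodd) (even_iff_two_dvd.mpr h')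
  -- the trivial candidates
  have heq : a ^ n + b ^ n = C * c ^ 2 := by simpa using hsol.1
  have hCc : (C : ℤ) * c ≠ 0 := by simpa using hsol.2.2.2.1
  by_cases htriv : a * b = 1 ∨ a * b = -1
  · exact no_trivial_solution C hC3 n hnodd a b c htriv hCc heq
  have hab1 : a * b ≠ 1 := fun h => htriv (Or.inl h)
  have hab2 : a * b ≠ -1 := fun h => htriv (Or.inr h)
  -- `a b A B C` odd
  have hodd5 : ¬ 2 ∣ a * b * (1 : ℕ) * (1 : ℕ) * (C : ℕ) := by
    intro h
    have h' : (2 : ℤ) ∣ a * b * C := by simpa using h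
    rcases Int.prime_two.dvd_mul.mp h' with h2 | h2
    · exact hodd h2
    · exact hCoddZ h2
  have hndvd : ¬ n ∣ 1 * 1 * C := by simpa using hnC
  have hfree : ∀ q : ℕ, q.Prime → ¬ q ^ n ∣ 1 ∧ ¬ q ^ n ∣ 1 := by
    intro q hq
    have : ¬ q ^ n ∣ 1 := by
      intro h
      have h1 := Nat.dvd_one.mp h
      rw [Nat.pow_eq_one] at h1
      rcases h1 with h1 | h1
      · exact hq.one_lt.ne' h1
      · omega
    exact ⟨this, this⟩
  have hL := (bs04Level_one_one C n hsq hCodd hnC).2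
  let fam : FreyDatum → Prop := fun S => S.A = 1 ∧ S.B = 1 ∧ S.C = C ∧ S.n = n ∧ ¬ 2 ∣ S.a * S.b
  rcases case_i_or_swap hsol hnodd hodd5 with hcase | hcase
  · obtain ⟨hlev, hmod⟩ := hP ⟨1, 1, C, n, a, b, c⟩ .i one_pos one_pos hCpos hsq hn h7 hndvd hfree
      hsol hab1 hab2 hcase
    obtain ⟨f, hf⟩ := hlev (32 * C ^ 2) hL
    exact M.no_newform_arises orbsO hDO fam ⟨1, 1, C, n, a, b, c⟩ ⟨rfl, rfl, rfl, rfl, hodd⟩ bs04Allowed hO f hf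
      (hmod _ f hf)
  · have hodd' : ¬ 2 ∣ b * a := by rw [mul_comm]; exact hodd
    have hba1 : b * a ≠ 1 := by rw [mul_comm]; exact hab1
    have hba2 : b * a ≠ -1 := by rw [mul_comm]; exact hab2
    obtain ⟨hlev, hmod⟩ := hP ⟨1, 1, C, n, b, a, c⟩ .i one_pos one_pos hCpos hsq hn h7 hndvd hfree
      hsol.swap hba1 hba2 hcase
    obtain ⟨f, hf⟩ := hlev (32 * C ^ 2) hL
    exact M.no_newform_arises orbsO hDO fam ⟨1, 1, C, n, b, a, c⟩ ⟨rfl, rfl, rfl, rfl, hodd'⟩ bs04Allowed hO f hf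
      (hmod _ f hf)

/-- **Row template, both parities.** For odd squarefree `C ≥ 3` and a prime `n ≥ 7`, `n ∤ C`: the hypotheses of
`row_template_even` (level `2C²`) and `row_template_odd` (level `32C²`) together give: NO primitive solution of
`xⁿ + yⁿ = C z²`. -/
theorem row_template (C : ℕ) (hC3 : 3 ≤ C) (hsq : Squarefree C) (hCodd : Odd C) (M : NewformModel)
    (hP : M.BS04Package) {orbsE orbsO : List OrbitData} (hDE : M.DataComplete (2 * C ^ 2) orbsE)
    (hDO : M.DataComplete (32 * C ^ 2) orbsO) (n : ℕ) (hn : n.Prime) (h7 : 7 ≤ n) (hnC : ¬ n ∣ C)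
    (hE : ∀ o ∈ orbsE, (∀ e ∈ o.coeffs, e.ell.Prime ∧ e.ell ≠ 2 ∧ ¬ e.ell ∣ 2 * C ^ 2) ∧
      (o.Eliminated bs04Allowed n ∨ M.Excludes (2 * C ^ 2) o
        (fun S => S.A = 1 ∧ S.B = 1 ∧ S.C = C ∧ S.n = n ∧ 2 ∣ S.a * S.b)))
    (hO : ∀ o ∈ orbsO, (∀ e ∈ o.coeffs, e.ell.Prime ∧ e.ell ≠ 2 ∧ ¬ e.ell ∣ 32 * C ^ 2) ∧
      (o.Eliminated bs04Allowed n ∨ M.Excludes (32 * C ^ 2) o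
        (fun S => S.A = 1 ∧ S.B = 1 ∧ S.C = C ∧ S.n = n ∧ ¬ 2 ∣ S.a * S.b)))
    (a b c : ℤ) : ¬ IsPrimitiveSolution 1 1 C n a b c := by
  by_cases hpar : 2 ∣ a * b
  · exact row_template_even C hsq hCodd M hP hDE n hn h7 hnC hE a b c hpar
  · exact row_template_odd C hC3 hsq hCodd M hP hDO n hn h7 hnC hO a b c hpar

end Summit.Ventures.AbcSig
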